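import Summits.HodgeConjecture.HodgeConjecture.Theorems.SixfoldTableXCensusWeilCMGeneralRows
import Summits.HodgeConjecture.HodgeConjecture.Theorems.SixfoldTableXCensusProductRowsUnitary
import HarnessLib

/-!
# TABLE X (dimension 6) — the PRODUCT Weil carriers, rows 17 `E_k × Y₅(3,2)`, 19 `Y₃ × Y₃′`, 22 `Y₃ × Z₃(CM)`, GENERAL MEMBERS
# (`Hg = S(A)(ℂ) ∩ SU_K = S(U × U)`): the census nodes X2 / X1 IN THE KERNEL under the displayed group hypothesis, with domain
# membership from the product structure (cell `pub-hodgeav-hg6`, req-37 (A) Q2b; eng-4 g6, L17; lead g2 2026-08-29T00:34:30Z GO)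

HONEST FRAMING. HC, `HC_AV` (stmt-1333), `HC_CM` (stmt-3052) and H2 are NOT proved and do not occur. The census nodes X2 / X1
(`TableX.SixfoldCodimTwoCensus` / `TableX.SixfoldCodimThreeCensus`) are OURS (`@[conjecture]`), never asserted. The GROUP hypothesis
«every `u ∈ S(A)(ℂ) = unitaryCentralizerGroup A h` with `det(u | W) = 1` lies in `Hg(A)(ℂ)|_{H¹}`» — the GENERAL member of each
product family — and Milne's single-generator / Rosati data are DISPLAYED on every theorem and never discharged; SPECIAL members
are NOT covered. KERNEL ONLY: theorems over existing declarations; no definition, no `sorry`, no named fact; the algebraicity of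
Weil classes is NOT touched (HC for these rows: L16's `WeilERows.hodgeConjectureFor_weilType_generalE_of_markman₆_nonsplit` applies
VERBATIM — it has no domain hypothesis; by TABLE X v1 §1 every member of rows 17 / 19 / 22 is SPLIT, an arithmetic fact not
formalised here); typed ≠ proved.

WHY THIS MODULE (census-node self-audit, axis A7, continued from L16 `SixfoldTableXCensusWeilCMGeneralRows`). The simple type-IV
Weil carriers with `End⁰ ⊋ K` (rows 11 / 13) were put on A7 by L16 over W1
(`HodgeTheory/WeilTypeHodgeRingOfCentralizerDetOne.isDivisorWeilGenerated_of_hodgeGroup_ge_unitaryCentralizer_detOne`). The cell's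
inventory (`HOME/jobs/A7-inventory-eng4g6/INVENTORY-g6-ADDENDUM.md` §3.2) observed that W1 applies VERBATIM to the PRODUCT Weil
carriers whose endomorphism algebra is still commutative and single-generated: `A ∼ Y × C` with

| row | `Y` (simple, not CM) | `C` (simple, `dim < 4`) | `End⁰(A)` | `S(A)(ℂ)` on `W = W_Y ⊕ W_C` | J1 (×2: eng-5 flint / eng-1 GAP) |
|---|---|---|---|---|---|
| 17 `g6.ExY5.(3,2)` | `Y₅`, type IV(1,0), `End⁰ = K`, signature `(3,2)` | `E_K` (CM curve, `(0,1)`) | `K × K` | `GL₅ × GL₁` | `exc = (0,0,2,0,0)`, `B³ = D³ ⊕ W_K` |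
| 19 `g6.Y3xY3p` | `Y₃`, `End⁰ = K`, `(2,1)` | `Y₃′ ≁ Y₃`, `End⁰ = K`, `(1,2)` | `K × K` | `GL₃ × GL₃` | `exc = (0,0,2,0,0)` (same `𝔥` as row 11) |
| 22 `g6.Y3xZ3CM` | `Y₃`, `End⁰ = K`, `(2,1)` | `Z₃` simple CM, `K ⊂ F = End⁰(Z₃)` sextic, `(1,2)` on `K` | `K × F` | `GL₃ × GL₁³` | `exc = (0,0,2,0,0)` |

(`K` acts on `A` diagonally with multiplicities `(3,3)`; the general member has `Hg = S(A) ∩ SU_K`, Lie algebra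
`𝔰(𝔤𝔩 ⊕ 𝔤𝔩 …)` as in `ENG-1-TASKS.md` J1.) So ONE census theorem with the DOMAIN proof as an input
(`census_weilType_general_of_not_residueClass`, L16's proof) serves both the simple rows (L16: `A` simple, not CM) and these
product rows, whose domain membership `dim A = 6 ∧ ¬ 𝒞 A` is L9c's `ProductRows.not_residueClass_of_isIsogenous_prod_of_isSimple_of_not_isOfCMType`
(`A ∼ Y × C`, `Y` simple not CM with `dim Y ≠ 4 ∨ rk End⁰(Y) ≠ 4`, `C` simple of dimension `< 4`): rows 17 (`dim Y = 5`, `dim C = 1`),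
19 and 22 (`dim Y = dim C = 3`). The Weil-type hypothesis `IsWeilType A φ 3 d` (the diagonal `K` acts `(3,3)`) and Milne's data
are stated ON `A` (the product), exactly as W1 consumes them. Rows 20 / 27 (`E_K² × Y₄`) are NOT covered: `End⁰ ⊇ M₂(K)` is not
single-generated (inventory §3.2).
* §1 `WeilERows.census_weilType_general_of_not_residueClass` — L16's census with `¬ 𝒞 A` as an input (any reason).
* §2 **`WeilERows.census_weilType_general_prod`** (+ `_of_isIsogenous`) — ROWS 17 / 19 / 22, GENERAL MEMBER: `(dim A = 6 ∧ ¬ 𝒞 A) ∧`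
  X2-at-`A` `∧` X1-at-`A`, for `A ∼ Y × C` as above.
NOT COVERED: special members; rows 20 / 27; the positivity facts; inhabitants; typed ≠ proved.
-/

set_option linter.dupNamespace false

noncomputable section

open CategoryTheory
open Literature.AlgebraicGeometry Literature.AlgebraicGeometry.Motives
open Literature.AlgebraicGeometry.Motives.AbelianVariety (IsIsogenous IsSimple)
open Literature.AlgebraicGeometry.HodgeTheory
open Literature.AlgebraicGeometry.Milne1999
open Literature.AlgebraicGeometry.VanGeemen1994 (pullbackOne hodgeGroupOne detOnEigenspace)
open Literature.AlgebraicTopology.SingularHomology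
open Literature.Barriers.HodgeConjecture
open Summit.HodgeConjecture.HodgeConjecture.Ring2.ClassTargets
open Summit.HodgeConjecture.HodgeConjecture.Ring2.Motiv (ProdCMCell)
open Summit.HodgeConjecture.HodgeConjecture.Ring2.Atlas (IsQuarticFieldTypeIVFourfold)

namespace Summit.HodgeConjecture.HodgeConjecture.TableX.WeilERows

variable (A : AbelianVariety ℂ) (φ : A ⟶ A) (d : ℕ) {h : complexBetti A.X 2}

/-! ## §1 The census at a general type-IV Weil member with the domain proof as an input -/

/-- **Census at `A` for a general Weil member, domain membership GIVEN.** `(A, φ)` of Weil type `(3, d)`, `A` off the residue class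
(`¬ 𝒞 A`, any reason), a rational class `h` with a Kähler multiple, Milne's single-generator data (`C(A) ⊗ ℂ` = commutant of one
diagonalisable `φ_E^*` with `Q_h`-adjoint `J'` in the bicommutant), `φ^*` a `d`-similitude of `Q_h`, and the DISPLAYED general-member
hypothesis «`Hg(A) ⊇ S(A)(ℂ) ∩ SU_K`»: `(dim A = 6 ∧ ¬ 𝒞 A) ∧` X2-at-`A` `∧` X1-at-`A` (W1
`isDivisorWeilGenerated_of_hodgeGroup_ge_unitaryCentralizer_detOne` + L16 §1). General member only; HC / HC_AV NOT proved.
[cite: Milne1999LefschetzClasses, Thm. 3.2 and Cor. 4.5] [cite: vanGeemen1994HodgeAV, Thm. 6.12 and 4.9]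
[cite: MoonenZarhin1999LowDim, (1.9) and (2.3)] -/
theorem census_weilType_general_of_not_residueClass (hW : IsWeilType A φ 3 d)
    (hdom : ¬ (IsOfCMType A ∨ ProdCMCell IsQuarticFieldTypeIVFourfold (fun Z ↦ Z.dim = 2) A))
    (φE : A ⟶ A) (hC : centralizerAlgebra A = Subalgebra.centralizer ℂ {pullbackOne A φE})
    (hdiag : ⨆ μ : ℂ, Module.End.eigenspace (pullbackOne A φE) μ = ⊤)
    (hQ : IsRationalClass h) (hK : ∃ s : ℝ, 0 < s ∧ IsKaehlerClass A.dim A.X ((s : ℂ) • h))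
    (J' : Module.End ℂ (complexBetti A.X 1))
    (hJ' : J' ∈ Subalgebra.centralizer ℂ (centralizerAlgebra A : Set (Module.End ℂ (complexBetti A.X 1))))
    (hJQ : ∀ x y : complexBetti A.X 1,
      polarizationPairingOne A.X h (A.dim - 1) (pullbackOne A φE x) y =
        polarizationPairingOne A.X h (A.dim - 1) x (J' y))
    (hφQ : ∀ x y, polarizationPairingOne A.X h (A.dim - 1) (pullbackOne A φ x) (pullbackOne A φ y) =
      (d : ℂ) • polarizationPairingOne A.X h (A.dim - 1) x y)
    (hG : ∀ (u : complexBetti A.X 1 ≃ₗ[ℂ] complexBetti A.X 1) (hu : u ∈ unitaryCentralizerGroup A h),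
      detOnEigenspace u (pullbackOne A φ) (fun x ↦ (mem_centralizerGroup_iff.1 hu.1) φ x)
        (Complex.I * (Real.sqrt d : ℂ)) = 1 → u ∈ hodgeGroupOne A.dim A.X) :
    (A.dim = 6 ∧ ¬ (IsOfCMType A ∨ ProdCMCell IsQuarticFieldTypeIVFourfold (fun Z ↦ Z.dim = 2) A)) ∧
    (∀ c : complexBetti A.X (2 * 2), IsRationalClass c → IsOfHodgeType A.dim A.X (2 * 2) 2 2 c →
      c ∈ divisorClassesSpan A.X A.dim 2 ⊔ Submodule.span ℂ {w' : complexBetti A.X (2 * 2) |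
        ∃ (C : AbelianVariety ℂ) (g : A.X ⟶ C.X) (w : complexBetti C.X (2 * 2)), C.dim < A.dim ∧
          IsRationalClass w ∧ IsOfHodgeType C.dim C.X (2 * 2) 2 2 w ∧ w' = complexBetti.map g (2 * 2) w}) ∧
    (∀ c : complexBetti A.X (2 * 3), IsRationalClass c → IsOfHodgeType A.dim A.X (2 * 3) 3 3 c →
      c ∈ divisorClassesSpan A.X A.dim 3 ⊔ Submodule.span ℂ {w' : complexBetti A.X (2 * 3) |
          ∃ (a : complexBetti A.X (2 * 2)) (b : complexBetti A.X (2 * 1)),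
            IsRationalClass a ∧ IsOfHodgeType A.dim A.X (2 * 2) 2 2 a ∧ IsRationalClass b ∧
            IsOfHodgeType A.dim A.X (2 * 1) 1 1 b ∧ w' = cupProduct (two_mul_add_two_mul 2 1) a b} ⊔
        Submodule.span ℂ {w' : complexBetti A.X (2 * 3) |
          ∃ (C : AbelianVariety ℂ) (g : A.X ⟶ C.X) (w : complexBetti C.X (2 * 3)), C.dim < A.dim ∧
            IsRationalClass w ∧ IsOfHodgeType C.dim C.X (2 * 3) 3 3 w ∧ w' = complexBetti.map g (2 * 3) w} ⊔
        Submodule.span ℂ {w' : complexBetti A.X (2 * 3) |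
          ∃ (B' : AbelianVariety ℂ) (g : A.X ⟶ B'.X) (d : ℕ) (ψ : B' ⟶ B') (w : complexBetti B'.X (2 * 3)),
            B'.dim = 6 ∧ 0 < d ∧ ψ ≫ ψ = -(d • 𝟙 B') ∧ IsRationalClass w ∧
            IsOfHodgeType B'.dim B'.X (2 * 3) 3 3 w ∧ w ∈ weilClassesOf B' ψ 3 d ∧
            w' = complexBetti.map g (2 * 3) w}) := by
  obtain ⟨hBD, hB3⟩ := isDivisorWeilGenerated_of_hodgeGroup_ge_unitaryCentralizer_detOne A φ (by norm_num)
    hW.dim_eq hW.d_pos hW.sq_eq φE hC hdiag hQ hK J' hJ' hJQ hφQ hG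
  refine ⟨⟨by rw [hW.dim_eq], hdom⟩, fun c hcQ hcH ↦ ?_, fun c hcQ hcH ↦ ?_⟩
  · exact Submodule.mem_sup_left (hBD 2 c (by norm_num) hcQ hcH)
  · obtain ⟨x, hx, y, hy, rfl⟩ := Submodule.mem_sup.1 (hB3 c hcQ hcH)
    exact Submodule.add_mem _ (Submodule.mem_sup_left (Submodule.mem_sup_left (Submodule.mem_sup_left hx)))
      (Submodule.mem_sup_right (weilClassesOf_le_weilSummand_of_isWeilType A φ d hW hy))

/-! ## §2 Rows 17 / 19 / 22: product Weil carriers `A ∼ Y × C`, general member -/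

/-- **TABLE X ROWS 17 `E_k × Y₅(3,2)` / 19 `Y₃ × Y₃′` / 22 `Y₃ × Z₃(CM)`, GENERAL MEMBER, KERNEL VERDICT WITH DOMAIN MEMBERSHIP.**
For `A` isogenous to `Y × C` with `Y` SIMPLE, NOT of CM type, `0 < dim Y` and (`dim Y ≠ 4` or `rk_ℚ End⁰(Y) ≠ 4`), `C` SIMPLE with
`0 < dim C < 4` (rows 17: `(dim Y, dim C) = (5, 1)`; 19, 22: `(3, 3)`), `(A, φ)` of Weil type `(3, d)` (`φ` = the diagonal `K`),
a rational class `h` on `A` with a Kähler multiple, Milne's single-generator data for `C(A) ⊗ ℂ` (`End⁰(A) = K × K`, resp.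
`K × F`, is commutative and generated by one element), `φ^*` a `d`-similitude of `Q_h`, and the DISPLAYED general-member
hypothesis «`Hg(A) ⊇ S(A)(ℂ) ∩ SU_K`» (`= S(U(W_Y) × U(W_C))`, J1: `𝔥 = 𝔰(𝔤𝔩 ⊕ 𝔤𝔩)`): `(dim A = 6 ∧ ¬ 𝒞 A)` — L9c
`ProductRows.not_residueClass_of_isIsogenous_prod_of_isSimple_of_not_isOfCMType` — AND X2-at-`A` (`B² ⊆ D² ⊗ ℂ`) AND X1-at-`A`
(`B³ ⊆ D³ ⊗ ℂ ⊔ W_K ⊗ ℂ`; J1 ×2: `exc = (0,0,2,0,0)` on each row). General member only; rows 20 / 27 not covered; HC / HC_AV NOT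
proved. [cite: MoonenZarhin1999LowDim, Thm. 0.2 and §5 (5.11)] [cite: Milne1999LefschetzClasses, §2 pp. 645–650, Thm. 3.2 and Cor. 4.5]
[cite: vanGeemen1994HodgeAV, Thm. 6.12 and 4.9] -/
theorem census_weilType_general_prod {Y C : AbelianVariety ℂ} (hYs : Y.IsSimple) (hYcm : ¬ IsOfCMType Y)
    (h0Y : 0 < Y.dim) (hY : Y.dim ≠ 4 ∨ Module.finrank ℚ Y.endAlgebra ≠ 4) (hCs : C.IsSimple) (h0C : 0 < C.dim)
    (hC4 : C.dim < 4) (hAYC : IsIsogenous A (Y.prod C)) (hW : IsWeilType A φ 3 d)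
    (φE : A ⟶ A) (hC : centralizerAlgebra A = Subalgebra.centralizer ℂ {pullbackOne A φE})
    (hdiag : ⨆ μ : ℂ, Module.End.eigenspace (pullbackOne A φE) μ = ⊤)
    (hQ : IsRationalClass h) (hK : ∃ s : ℝ, 0 < s ∧ IsKaehlerClass A.dim A.X ((s : ℂ) • h))
    (J' : Module.End ℂ (complexBetti A.X 1))
    (hJ' : J' ∈ Subalgebra.centralizer ℂ (centralizerAlgebra A : Set (Module.End ℂ (complexBetti A.X 1))))
    (hJQ : ∀ x y : complexBetti A.X 1,
      polarizationPairingOne A.X h (A.dim - 1) (pullbackOne A φE x) y =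
        polarizationPairingOne A.X h (A.dim - 1) x (J' y))
    (hφQ : ∀ x y, polarizationPairingOne A.X h (A.dim - 1) (pullbackOne A φ x) (pullbackOne A φ y) =
      (d : ℂ) • polarizationPairingOne A.X h (A.dim - 1) x y)
    (hG : ∀ (u : complexBetti A.X 1 ≃ₗ[ℂ] complexBetti A.X 1) (hu : u ∈ unitaryCentralizerGroup A h),
      detOnEigenspace u (pullbackOne A φ) (fun x ↦ (mem_centralizerGroup_iff.1 hu.1) φ x)
        (Complex.I * (Real.sqrt d : ℂ)) = 1 → u ∈ hodgeGroupOne A.dim A.X) :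
    (A.dim = 6 ∧ ¬ (IsOfCMType A ∨ ProdCMCell IsQuarticFieldTypeIVFourfold (fun Z ↦ Z.dim = 2) A)) ∧
    (∀ c : complexBetti A.X (2 * 2), IsRationalClass c → IsOfHodgeType A.dim A.X (2 * 2) 2 2 c →
      c ∈ divisorClassesSpan A.X A.dim 2 ⊔ Submodule.span ℂ {w' : complexBetti A.X (2 * 2) |
        ∃ (C : AbelianVariety ℂ) (g : A.X ⟶ C.X) (w : complexBetti C.X (2 * 2)), C.dim < A.dim ∧
          IsRationalClass w ∧ IsOfHodgeType C.dim C.X (2 * 2) 2 2 w ∧ w' = complexBetti.map g (2 * 2) w}) ∧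
    (∀ c : complexBetti A.X (2 * 3), IsRationalClass c → IsOfHodgeType A.dim A.X (2 * 3) 3 3 c →
      c ∈ divisorClassesSpan A.X A.dim 3 ⊔ Submodule.span ℂ {w' : complexBetti A.X (2 * 3) |
          ∃ (a : complexBetti A.X (2 * 2)) (b : complexBetti A.X (2 * 1)),
            IsRationalClass a ∧ IsOfHodgeType A.dim A.X (2 * 2) 2 2 a ∧ IsRationalClass b ∧
            IsOfHodgeType A.dim A.X (2 * 1) 1 1 b ∧ w' = cupProduct (two_mul_add_two_mul 2 1) a b} ⊔
        Submodule.span ℂ {w' : complexBetti A.X (2 * 3) |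
          ∃ (C : AbelianVariety ℂ) (g : A.X ⟶ C.X) (w : complexBetti C.X (2 * 3)), C.dim < A.dim ∧
            IsRationalClass w ∧ IsOfHodgeType C.dim C.X (2 * 3) 3 3 w ∧ w' = complexBetti.map g (2 * 3) w} ⊔
        Submodule.span ℂ {w' : complexBetti A.X (2 * 3) |
          ∃ (B' : AbelianVariety ℂ) (g : A.X ⟶ B'.X) (d : ℕ) (ψ : B' ⟶ B') (w : complexBetti B'.X (2 * 3)),
            B'.dim = 6 ∧ 0 < d ∧ ψ ≫ ψ = -(d • 𝟙 B') ∧ IsRationalClass w ∧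
            IsOfHodgeType B'.dim B'.X (2 * 3) 3 3 w ∧ w ∈ weilClassesOf B' ψ 3 d ∧
            w' = complexBetti.map g (2 * 3) w}) :=
  census_weilType_general_of_not_residueClass A φ d hW
    (ProductRows.not_residueClass_of_isIsogenous_prod_of_isSimple_of_not_isOfCMType hYs hYcm h0Y hY hCs h0C hC4 hAYC)
    φE hC hdiag hQ hK J' hJ' hJQ hφQ hG

/-- **Rows 17 / 19 / 22, general member, on the whole ISOGENY CLASS of `A`** (L7 `offResidueSix_iff_of_isIsogenous`, L7b
`codimTwo/ThreeCensusAt_iff_of_isIsogenous`). General member only. [cite: MoonenZarhin1999LowDim, Thm. 0.2 and §5 (5.1), (5.11)]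
[cite: Milne1999LefschetzClasses, Thm. 3.2 and Cor. 4.5] [cite: vanGeemen1994HodgeAV, Lemma 3.7 and Thm. 6.12] -/
theorem census_weilType_general_prod_of_isIsogenous {A' Y C : AbelianVariety ℂ} (hYs : Y.IsSimple) (hYcm : ¬ IsOfCMType Y)
    (h0Y : 0 < Y.dim) (hY : Y.dim ≠ 4 ∨ Module.finrank ℚ Y.endAlgebra ≠ 4) (hCs : C.IsSimple) (h0C : 0 < C.dim)
    (hC4 : C.dim < 4) (hAYC : IsIsogenous A (Y.prod C)) (hW : IsWeilType A φ 3 d)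
    (φE : A ⟶ A) (hC : centralizerAlgebra A = Subalgebra.centralizer ℂ {pullbackOne A φE})
    (hdiag : ⨆ μ : ℂ, Module.End.eigenspace (pullbackOne A φE) μ = ⊤)
    (hQ : IsRationalClass h) (hK : ∃ s : ℝ, 0 < s ∧ IsKaehlerClass A.dim A.X ((s : ℂ) • h))
    (J' : Module.End ℂ (complexBetti A.X 1))
    (hJ' : J' ∈ Subalgebra.centralizer ℂ (centralizerAlgebra A : Set (Module.End ℂ (complexBetti A.X 1))))
    (hJQ : ∀ x y : complexBetti A.X 1,
      polarizationPairingOne A.X h (A.dim - 1) (pullbackOne A φE x) y =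
        polarizationPairingOne A.X h (A.dim - 1) x (J' y))
    (hφQ : ∀ x y, polarizationPairingOne A.X h (A.dim - 1) (pullbackOne A φ x) (pullbackOne A φ y) =
      (d : ℂ) • polarizationPairingOne A.X h (A.dim - 1) x y)
    (hG : ∀ (u : complexBetti A.X 1 ≃ₗ[ℂ] complexBetti A.X 1) (hu : u ∈ unitaryCentralizerGroup A h),
      detOnEigenspace u (pullbackOne A φ) (fun x ↦ (mem_centralizerGroup_iff.1 hu.1) φ x)
        (Complex.I * (Real.sqrt d : ℂ)) = 1 → u ∈ hodgeGroupOne A.dim A.X)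
    (hA'A : IsIsogenous A' A) :
    (A'.dim = 6 ∧ ¬ (IsOfCMType A' ∨ ProdCMCell IsQuarticFieldTypeIVFourfold (fun Z ↦ Z.dim = 2) A')) ∧
    (∀ c : complexBetti A'.X (2 * 2), IsRationalClass c → IsOfHodgeType A'.dim A'.X (2 * 2) 2 2 c →
      c ∈ divisorClassesSpan A'.X A'.dim 2 ⊔ Submodule.span ℂ {w' : complexBetti A'.X (2 * 2) |
        ∃ (C : AbelianVariety ℂ) (g : A'.X ⟶ C.X) (w : complexBetti C.X (2 * 2)), C.dim < A'.dim ∧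
          IsRationalClass w ∧ IsOfHodgeType C.dim C.X (2 * 2) 2 2 w ∧ w' = complexBetti.map g (2 * 2) w}) ∧
    (∀ c : complexBetti A'.X (2 * 3), IsRationalClass c → IsOfHodgeType A'.dim A'.X (2 * 3) 3 3 c →
      c ∈ divisorClassesSpan A'.X A'.dim 3 ⊔ Submodule.span ℂ {w' : complexBetti A'.X (2 * 3) |
          ∃ (a : complexBetti A'.X (2 * 2)) (b : complexBetti A'.X (2 * 1)),
            IsRationalClass a ∧ IsOfHodgeType A'.dim A'.X (2 * 2) 2 2 a ∧ IsRationalClass b ∧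
            IsOfHodgeType A'.dim A'.X (2 * 1) 1 1 b ∧ w' = cupProduct (two_mul_add_two_mul 2 1) a b} ⊔
        Submodule.span ℂ {w' : complexBetti A'.X (2 * 3) |
          ∃ (C : AbelianVariety ℂ) (g : A'.X ⟶ C.X) (w : complexBetti C.X (2 * 3)), C.dim < A'.dim ∧
            IsRationalClass w ∧ IsOfHodgeType C.dim C.X (2 * 3) 3 3 w ∧ w' = complexBetti.map g (2 * 3) w} ⊔
        Submodule.span ℂ {w' : complexBetti A'.X (2 * 3) |
          ∃ (B' : AbelianVariety ℂ) (g : A'.X ⟶ B'.X) (d : ℕ) (ψ : B' ⟶ B') (w : complexBetti B'.X (2 * 3)),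
            B'.dim = 6 ∧ 0 < d ∧ ψ ≫ ψ = -(d • 𝟙 B') ∧ IsRationalClass w ∧
            IsOfHodgeType B'.dim B'.X (2 * 3) 3 3 w ∧ w ∈ weilClassesOf B' ψ 3 d ∧
            w' = complexBetti.map g (2 * 3) w}) := by
  obtain ⟨hdom, h2, h3⟩ := census_weilType_general_prod A φ d hYs hYcm h0Y hY hCs h0C hC4 hAYC hW φE hC hdiag hQ hK J' hJ'
    hJQ hφQ hG
  exact ⟨(offResidueSix_iff_of_isIsogenous hA'A).mpr hdom, (codimTwoCensusAt_iff_of_isIsogenous hA'A).mpr h2,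
    (codimThreeCensusAt_iff_of_isIsogenous hA'A).mpr h3⟩

end Summit.HodgeConjecture.HodgeConjecture.TableX.WeilERows
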